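import Literature.NumberTheory.DiophantineGeometry.FunctionFieldPlaceOfFactor
import Literature.NumberTheory.DiophantineGeometry.FunctionFieldTotallyRamifiedStep
import HarnessLib

/-!
# Kummer's theorem: unramified places and complete splitting from the reduced minimal polynomial
(Stichtenoth Thm. 3.3.7, Cor. 3.3.8)

Topic: `Literature/NumberTheory/DiophantineGeometry`. Let `F'/F` be a finite separable extension of
algebraic function fields over a finite field `K`, `P` a place of `F`, `y ∈ F'` with
`[F' : F] = deg φ` where `φ ∈ 𝒪_P[T]` is monic with `φ = minpoly_F(y)`, and suppose the reduction
`φ̄ ∈ F_P[T]` is a product `φ̄ = ∏_{γ ∈ S} γ` of DISTINCT monic irreducible polynomials (e.g. `φ̄`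
separable). **Kummer's theorem** [Stichtenoth 2009, Thm. 3.3.7]: the places of `F'` above `P` are in
bijection with `S`, `γ ↦ P_γ` with `γ(ȳ) = 0` in `F'_{P_γ}`, all of them are unramified
(`e(P_γ|P) = 1`) and `deg P_γ = deg γ · deg P` (`f(P_γ|P) = deg γ`):

* `PlaceOver.exists_placesOver_of_prod_eq` — the bijection with these properties;
* `PlaceOver.ord_algebraMap_uniformizer_eq_one_of_separable` — **if `φ̄` is separable, every place
  above `P` is unramified** (Cor. 3.3.8 (c) / Dedekind);
* `PlaceOver.exists_placesOver_of_splits` — **complete splitting** (Cor. 3.3.8 (b)): if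
  `φ̄ = ∏ᵢ (T - c̄ᵢ)` with distinct `c̄ᵢ` (`cᵢ ∈ 𝒪_P`), there are `[F' : F]` distinct places `Pᵢ` above
  `P`, with `deg Pᵢ = deg P` and `y ≡ cᵢ (mod Pᵢ)`.

Proof: existence of `P_γ` for each `γ` is `FunctionFieldPlaceOfFactor`; distinct `γ` give distinct
places (coprime polynomials have no common root `ȳ`); then
`[F':F] deg P = ∑_{P'|P} e(P'|P) deg P' ≥ ∑_γ e(P_γ|P) deg P_γ ≥ ∑_γ deg P_γ ≥ ∑_γ deg γ deg P = [F':F] deg P`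
(fundamental equality `FunctionFieldFundamentalEquality` and `deg γ deg P ≤ deg P_γ`), so equality
holds throughout. These are the facts behind Lemma 7.4.4 (complete splitting of `x₀ = α`,
`α ∈ 𝔽_{ℓ²} ∖ 𝔽_ℓ`) and the unramifiedness outside `𝔽_ℓ ∪ {∞}` (Lemma 7.4.5) in the Garcia–Stichtenoth
tower.

## References

* H. Stichtenoth, *Algebraic Function Fields and Codes*, 2nd ed., GTM 254, Springer 2009: Thm. 3.3.7,
  Cor. 3.3.8, Lemma 7.4.4, Lemma 7.4.5. [Stichtenoth2009]
-/

noncomputable section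

open scoped Classical Polynomial IntermediateField
open Polynomial

namespace Literature.NumberTheory.DiophantineGeometry.AlgFunctionField

namespace PlaceOver

universe u v

variable {K : Type u} {F : Type v} {F' : Type v} [Field K] [Field F] [Algebra K F]
variable [Field F'] [Algebra F F'] [Algebra K F'] [IsScalarTower K F F']
variable [IsAlgFunctionField K F] [FiniteDimensional F F'] [Algebra.IsSeparable F F'] [Finite K]
  [IsAlgFunctionField K F']

omit [IsScalarTower K F F'] [IsAlgFunctionField K F] [FiniteDimensional F F'] [Algebra.IsSeparable F F']
  [Finite K] [IsAlgFunctionField K F'] in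
/-- Two coprime polynomials over `F_P` have no common root in `F'_{P'}`. [folklore] -/
theorem not_isCoprime_of_aeval_eq_zero {P : PlaceOver K F} {P' : PlaceOver K F'}
    (hBP : ∀ x : F, algebraMap F F' x ∈ P'.toValuationSubring ↔ x ∈ P.toValuationSubring)
    {g₁ g₂ : (P.residueField)[X]} (z : P'.residueField)
    (h₁ : aeval z (g₁.map (IsLocalRing.ResidueField.map (resHom P P' hBP))) = 0)
    (h₂ : aeval z (g₂.map (IsLocalRing.ResidueField.map (resHom P P' hBP))) = 0) :
    ¬IsCoprime g₁ g₂ := by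
  intro hc
  obtain ⟨a, b, hab⟩ := hc.map (Polynomial.mapRingHom (IsLocalRing.ResidueField.map (resHom P P' hBP)))
  have := congrArg (aeval z) hab
  simp only [coe_mapRingHom, map_add, map_mul, h₁, h₂, mul_zero, add_zero, map_one] at this
  exact zero_ne_one this

/-- **Kummer's theorem** (Stichtenoth Thm. 3.3.7). Let `φ ∈ 𝒪_P[T]` be monic with
`φ = minpoly_F(y)`, `[F' : F] = deg φ`, and `φ̄ = ∏_{γ ∈ S} γ` with `S` a finite set of monic
irreducible polynomials over `F_P`. Then there are places `P_γ` (`γ ∈ S`) above `P`, pairwise distinct,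
exhausting the places above `P`, with `y ∈ 𝒪_{P_γ}`, `γ(ȳ) = 0` in `F'_{P_γ}`, `e(P_γ|P) = 1` and
`deg P_γ = deg γ · deg P`. [cite: Stichtenoth2009, Thm. 3.3.7] -/
theorem exists_placesOver_of_prod_eq (P : PlaceOver K F) {y : F'}
    {φ : (P.toValuationSubring)[X]} (hφm : φ.Monic)
    (hφ : minpoly F y = φ.map (algebraMap P.toValuationSubring F))
    (hdeg : Module.finrank F F' = φ.natDegree)
    (S : Finset (P.residueField)[X]) (hirr : ∀ γ ∈ S, Irreducible γ) (hmon : ∀ γ ∈ S, γ.Monic)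
    (hprod : ∏ γ ∈ S, γ = φ.map (IsLocalRing.residue P.toValuationSubring)) :
    ∃ Φ : (P.residueField)[X] → PlaceOver K F',
      Set.InjOn Φ S ∧
      (∀ P' : PlaceOver K F', P'.restrict (K := K) (F := F) = P → ∃ γ ∈ S, Φ γ = P') ∧
      ∀ γ ∈ S, (Φ γ).restrict (K := K) (F := F) = P ∧
        (∀ (hBP : ∀ x : F, algebraMap F F' x ∈ (Φ γ).toValuationSubring ↔ x ∈ P.toValuationSubring)
          (hy : y ∈ (Φ γ).toValuationSubring),
          aeval (IsLocalRing.residue (Φ γ).toValuationSubring ⟨y, hy⟩)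
            (γ.map (IsLocalRing.ResidueField.map (resHom P (Φ γ) hBP))) = 0) ∧
        (Φ γ).ord (algebraMap F F' (P.uniformizer : F)) = 1 ∧
        (Φ γ).degree = γ.natDegree * P.degree := by
  -- each `γ ∈ S` divides `φ̄`; choose a place `Φ γ` above `P` with `γ(ȳ) = 0`
  have hdvd : ∀ γ ∈ S, γ ∣ φ.map (IsLocalRing.residue P.toValuationSubring) := fun γ hγ => by
    rw [← hprod]; exact Finset.dvd_prod_of_mem _ hγ
  obtain ⟨P₀, hP₀⟩ := P.exists_restrict_eq' (F' := F')
  have hex := fun γ (hγ : γ ∈ S) =>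
    P.exists_placeOver_aeval_residue_eq_zero hφm hφ (hirr γ hγ) (hdvd γ hγ)
  set Φ : (P.residueField)[X] → PlaceOver K F' := fun γ =>
    if hγ : γ ∈ S then (hex γ hγ).choose else P₀ with hΦ
  have hΦspec : ∀ γ (hγ : γ ∈ S), ∃ (hBP : ∀ x : F, algebraMap F F' x ∈ (Φ γ).toValuationSubring ↔
      x ∈ P.toValuationSubring) (hy : y ∈ (Φ γ).toValuationSubring),
      aeval (IsLocalRing.residue (Φ γ).toValuationSubring ⟨y, hy⟩)
        (γ.map (IsLocalRing.ResidueField.map (resHom P (Φ γ) hBP))) = 0 := by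
    intro γ hγ
    have hΦγ : Φ γ = (hex γ hγ).choose := dif_pos hγ
    rw [hΦγ]
    exact (hex γ hγ).choose_spec
  have hres : ∀ γ ∈ S, (Φ γ).restrict (K := K) (F := F) = P := fun γ hγ => by
    obtain ⟨hBP, -, -⟩ := hΦspec γ hγ
    exact (restrict_eq_iff _ _).2 hBP
  have hroot : ∀ γ ∈ S, ∀ (hBP : ∀ x : F, algebraMap F F' x ∈ (Φ γ).toValuationSubring ↔
      x ∈ P.toValuationSubring) (hy : y ∈ (Φ γ).toValuationSubring),
      aeval (IsLocalRing.residue (Φ γ).toValuationSubring ⟨y, hy⟩)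
        (γ.map (IsLocalRing.ResidueField.map (resHom P (Φ γ) hBP))) = 0 := by
    intro γ hγ hBP hy
    obtain ⟨hBP', hy', h⟩ := hΦspec γ hγ
    exact h
  have hdegle : ∀ γ ∈ S, γ.natDegree * P.degree ≤ (Φ γ).degree := fun γ hγ => by
    obtain ⟨hBP, hy, h⟩ := hΦspec γ hγ
    exact natDegree_mul_degree_le_degree hBP (hirr γ hγ) ⟨y, hy⟩ h
  -- distinct factors give distinct places
  have hinj : Set.InjOn Φ S := by
    intro γ₁ h₁ γ₂ h₂ heq
    by_contra hne
    have hcop : IsCoprime γ₁ γ₂ := by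
      rw [(hirr γ₁ h₁).coprime_iff_not_dvd]
      intro hd
      exact hne (eq_of_monic_of_associated (hmon γ₁ h₁) (hmon γ₂ h₂)
        ((hirr γ₁ h₁).associated_of_dvd (hirr γ₂ h₂) hd))
    obtain ⟨hBP, hy, hr₁⟩ := hΦspec γ₁ h₁
    have hr₂ := hroot γ₂ h₂
    rw [← heq] at hr₂
    exact not_isCoprime_of_aeval_eq_zero hBP _ hr₁ (hr₂ hBP hy) hcop
  -- the count
  set T := (P.finite_setOf_restrict_eq (F' := F')).toFinset with hT
  have hTmem := P.mem_toFinset_restrict_eq_iff (F' := F')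
  have hsumT := P.sum_ramification_mul_degree_eq (F' := F') T hTmem
  have himage : S.image Φ ⊆ T := by
    intro P' hP'
    obtain ⟨γ, hγ, rfl⟩ := Finset.mem_image.1 hP'
    exact (hTmem _).2 (hres γ hγ)
  have he1 : ∀ γ ∈ S, 1 ≤ (Φ γ).ord (algebraMap F F' (P.uniformizer : F)) := fun γ hγ => by
    have := (Φ γ).one_le_ord_algebraMap_uniformizer (K := K) (F := F)
    rwa [hres γ hγ] at this
  have hnonnegT : ∀ Q ∈ T, 0 ≤ Q.ord (algebraMap F F' (P.uniformizer : F)) * (Q.degree : ℤ) := by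
    intro Q hQ
    have := Q.one_le_ord_algebraMap_uniformizer (K := K) (F := F)
    rw [(hTmem Q).1 hQ] at this
    positivity
  have hnatdeg : ∑ γ ∈ S, γ.natDegree = φ.natDegree := by
    rw [← natDegree_prod _ _ (fun γ hγ => (hirr γ hγ).ne_zero), hprod, hφm.natDegree_map]
  -- `A = ∑_T e deg = n deg P`, `B = ∑_{image} e deg`, `C = ∑_S deg (Φ γ)`, `D = ∑_S deg γ deg P`
  have hAB : ∑ Q ∈ S.image Φ, Q.ord (algebraMap F F' (P.uniformizer : F)) * (Q.degree : ℤ) ≤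
      ∑ Q ∈ T, Q.ord (algebraMap F F' (P.uniformizer : F)) * (Q.degree : ℤ) :=
    Finset.sum_le_sum_of_subset_of_nonneg himage fun Q hQ _ => hnonnegT Q hQ
  rw [Finset.sum_image hinj] at hAB
  have hBC : ∀ γ ∈ S, ((Φ γ).degree : ℤ) ≤
      (Φ γ).ord (algebraMap F F' (P.uniformizer : F)) * ((Φ γ).degree : ℤ) := fun γ hγ => by
    have := he1 γ hγ; have : (0 : ℤ) ≤ (Φ γ).degree := by positivity
    nlinarith
  have hCD : ∀ γ ∈ S, (γ.natDegree : ℤ) * P.degree ≤ ((Φ γ).degree : ℤ) := fun γ hγ => by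
    exact_mod_cast hdegle γ hγ
  have hDA : ∑ γ ∈ S, (γ.natDegree : ℤ) * P.degree = Module.finrank F F' * (P.degree : ℤ) := by
    rw [← Finset.sum_mul, hdeg, ← hnatdeg]; push_cast; rfl
  have hsum₁ := Finset.sum_le_sum hCD
  have hsum₂ := Finset.sum_le_sum hBC
  -- equality everywhere
  have hCD' : ∑ γ ∈ S, (((Φ γ).degree : ℤ) - (γ.natDegree : ℤ) * P.degree) = 0 := by
    rw [Finset.sum_sub_distrib]; linarith
  have hBC' : ∑ γ ∈ S, ((Φ γ).ord (algebraMap F F' (P.uniformizer : F)) * ((Φ γ).degree : ℤ) -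
      ((Φ γ).degree : ℤ)) = 0 := by
    rw [Finset.sum_sub_distrib]; linarith
  rw [Finset.sum_eq_zero_iff_of_nonneg (fun γ hγ => sub_nonneg.2 (hCD γ hγ))] at hCD'
  rw [Finset.sum_eq_zero_iff_of_nonneg (fun γ hγ => sub_nonneg.2 (hBC γ hγ))] at hBC'
  have hdegeq : ∀ γ ∈ S, (Φ γ).degree = γ.natDegree * P.degree := fun γ hγ => by
    have := hCD' γ hγ; exact_mod_cast (sub_eq_zero.1 this)
  have heeq : ∀ γ ∈ S, (Φ γ).ord (algebraMap F F' (P.uniformizer : F)) = 1 := fun γ hγ => by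
    have h := sub_eq_zero.1 (hBC' γ hγ)
    have hd : ((Φ γ).degree : ℤ) ≠ 0 := by
      have := PlaceOver.degree_pos_holds (Φ γ); positivity
    have : ((Φ γ).ord (algebraMap F F' (P.uniformizer : F)) - 1) * ((Φ γ).degree : ℤ) = 0 := by
      linarith
    linarith [(mul_eq_zero.1 this).resolve_right hd]
  -- every place above `P` is some `Φ γ`
  have hAB' : ∑ Q ∈ T \ S.image Φ, Q.ord (algebraMap F F' (P.uniformizer : F)) * (Q.degree : ℤ) = 0 := by
    have := Finset.sum_sdiff himage (f := fun Q : PlaceOver K F' =>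
      Q.ord (algebraMap F F' (P.uniformizer : F)) * (Q.degree : ℤ))
    rw [Finset.sum_image hinj] at this
    linarith
  rw [Finset.sum_eq_zero_iff_of_nonneg (fun Q hQ => hnonnegT Q (Finset.mem_sdiff.1 hQ).1)] at hAB'
  have hall : ∀ P' : PlaceOver K F', P'.restrict (K := K) (F := F) = P → ∃ γ ∈ S, Φ γ = P' := by
    intro P' hP'
    by_contra hno
    push Not at hno
    have hmem : P' ∈ T \ S.image Φ := by
      refine Finset.mem_sdiff.2 ⟨(hTmem P').2 hP', fun h => ?_⟩
      obtain ⟨γ, hγ, hγP'⟩ := Finset.mem_image.1 h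
      exact hno γ hγ hγP'
    have h0 := hAB' P' hmem
    have h1 := P'.one_le_ord_algebraMap_uniformizer (K := K) (F := F)
    rw [hP'] at h1
    have h2 : (0 : ℤ) < P'.degree := by exact_mod_cast PlaceOver.degree_pos_holds P'
    nlinarith
  exact ⟨Φ, hinj, hall, fun γ hγ => ⟨hres γ hγ, hroot γ hγ, heeq γ hγ, hdegeq γ hγ⟩⟩

/-! ### Separable reduction: every place above `P` is unramified -/

/-- **Kummer's theorem, Cor. 3.3.8 (c) / Dedekind**: if `φ̄` is separable then `e(P'|P) = 1` for every
place `P'` above `P` (with `φ ∈ 𝒪_P[T]` monic, `φ = minpoly_F(y)`, `[F' : F] = deg φ`).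
[cite: Stichtenoth2009, Cor. 3.3.8] -/
theorem ord_algebraMap_uniformizer_eq_one_of_separable (P : PlaceOver K F) {y : F'}
    {φ : (P.toValuationSubring)[X]} (hφm : φ.Monic)
    (hφ : minpoly F y = φ.map (algebraMap P.toValuationSubring F))
    (hdeg : Module.finrank F F' = φ.natDegree)
    (hsep : (φ.map (IsLocalRing.residue P.toValuationSubring)).Separable)
    {P' : PlaceOver K F'} (h : P'.restrict (K := K) (F := F) = P) :
    P'.ord (algebraMap F F' (P.uniformizer : F)) = 1 := by
  set φb := φ.map (IsLocalRing.residue P.toValuationSubring) with hφb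
  have hφbm : φb.Monic := hφm.map _
  have hφb0 : φb ≠ 0 := hφbm.ne_zero
  set S := (UniqueFactorizationMonoid.normalizedFactors φb).toFinset with hS
  have hmemS : ∀ γ ∈ S, γ ∈ UniqueFactorizationMonoid.normalizedFactors φb := fun γ hγ =>
    Multiset.mem_toFinset.1 hγ
  have hirr : ∀ γ ∈ S, Irreducible γ := fun γ hγ =>
    UniqueFactorizationMonoid.irreducible_of_normalized_factor γ (hmemS γ hγ)
  have hmon : ∀ γ ∈ S, γ.Monic := fun γ hγ => by
    rw [← UniqueFactorizationMonoid.normalize_normalized_factor γ (hmemS γ hγ)]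
    exact Polynomial.monic_normalize (hirr γ hγ).ne_zero
  have hnodup : (UniqueFactorizationMonoid.normalizedFactors φb).Nodup :=
    (UniqueFactorizationMonoid.squarefree_iff_nodup_normalizedFactors hφb0).1 hsep.squarefree
  have hprod : ∏ γ ∈ S, γ = φb := by
    have hSm : (∏ γ ∈ S, γ).Monic := monic_prod_of_monic _ _ fun γ hγ => hmon γ hγ
    have h1 : ∏ γ ∈ S, γ = (UniqueFactorizationMonoid.normalizedFactors φb).prod := by
      rw [Finset.prod_eq_multiset_prod, hS, Multiset.toFinset_val, hnodup.dedup, Multiset.map_id']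
    rw [h1] at hSm ⊢
    exact Polynomial.eq_of_monic_of_associated hSm hφbm
      (UniqueFactorizationMonoid.prod_normalizedFactors hφb0)
  obtain ⟨Φ, -, hall, hspec⟩ := P.exists_placesOver_of_prod_eq hφm hφ hdeg S hirr hmon hprod
  obtain ⟨γ, hγ, rfl⟩ := hall P' h
  exact (hspec γ hγ).2.2.1

/-! ### The polynomials `T^q - T - w` -/

omit [IsScalarTower K F F'] [IsAlgFunctionField K F] [Algebra.IsSeparable F F'] [Finite K]
  [IsAlgFunctionField K F'] in
/-- If `y^q - y = w` generates `F'/F` of degree `q` then `T^q - T - w = minpoly_F(y)`. [folklore] -/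
theorem minpoly_eq_of_pow_sub_eq {q : ℕ} (hq : 2 ≤ q) {y : F'} {w : F}
    (hy : y ^ q - y = algebraMap F F' w) (htop : F⟮y⟯ = ⊤) (hdeg : Module.finrank F F' = q) :
    minpoly F y = X ^ q - X - C w := by
  have hint : IsIntegral F y := Algebra.IsIntegral.isIntegral y
  have hroot : aeval y (X ^ q - X - C w : F[X]) = 0 := by
    simp only [map_sub, map_pow, aeval_X, aeval_C, hy, sub_self]
  have hnat : (minpoly F y).natDegree = q := by
    rw [← IntermediateField.adjoin.finrank hint, htop, IntermediateField.finrank_top', hdeg]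
  refine (Polynomial.eq_of_monic_of_dvd_of_natDegree_le (minpoly.monic hint)
    (monic_X_pow_sub_X_sub_C w hq) (minpoly.dvd F y hroot) ?_).symm
  rw [hnat, natDegree_X_pow_sub_X_sub_C w hq]

omit [IsAlgFunctionField K F] [FiniteDimensional F F'] [Algebra.IsSeparable F F'] [Finite K]
  [IsAlgFunctionField K F'] [Algebra F F'] [IsScalarTower K F F'] in
/-- Over a residue field in which `q = 0`, `T^q - T - c` is separable (its derivative is `-1`).
[cite: Stichtenoth2009, Prop. 3.7.10 (proof)] -/
theorem separable_X_pow_sub_X_sub_C {R : Type*} [CommRing R] {q : ℕ} (hq : (q : R) = 0) (c : R) :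
    (X ^ q - X - C c : R[X]).Separable := by
  rw [Polynomial.separable_def, derivative_sub, derivative_sub, derivative_X_pow, derivative_X,
    derivative_C, sub_zero, hq, C_0, zero_mul, zero_sub]
  exact ⟨0, -1, by ring⟩

/-- **Unramifiedness of `y^q - y = w`, `w ∈ 𝒪_P`** (Stichtenoth Prop. 3.7.8 (c) / 3.7.10 (c), over a
residue field of characteristic dividing `q`): every place above `P` has `e(P'|P) = 1`.
[cite: Stichtenoth2009, Prop. 3.7.10] -/
theorem ord_algebraMap_uniformizer_eq_one_of_pow_sub_eq (P : PlaceOver K F) {q : ℕ} (hq : 2 ≤ q)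
    (hqK : (q : K) = 0) {y : F'} {w : F} (hw : w ∈ P.toValuationSubring)
    (hy : y ^ q - y = algebraMap F F' w) (htop : F⟮y⟯ = ⊤) (hdeg : Module.finrank F F' = q)
    {P' : PlaceOver K F'} (h : P'.restrict (K := K) (F := F) = P) :
    P'.ord (algebraMap F F' (P.uniformizer : F)) = 1 := by
  set φ : (P.toValuationSubring)[X] := X ^ q - X - C ⟨w, hw⟩ with hφ
  have hφmap : φ.map (algebraMap P.toValuationSubring F) = X ^ q - X - C w := by
    simp only [hφ, Polynomial.map_sub, Polynomial.map_pow, map_X, map_C]; rfl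
  have hqres : (q : P.residueField) = 0 := by
    rw [← map_natCast (algebraMap K P.residueField), hqK, map_zero]
  refine P.ord_algebraMap_uniformizer_eq_one_of_separable (φ := φ) (monic_X_pow_sub_X_sub_C _ hq)
    (by rw [hφmap]; exact minpoly_eq_of_pow_sub_eq hq hy htop hdeg)
    (by rw [hdeg, natDegree_X_pow_sub_X_sub_C _ hq]) ?_ h
  simp only [hφ, Polynomial.map_sub, Polynomial.map_pow, map_X, map_C]
  exact separable_X_pow_sub_X_sub_C hqres _

/-- **Complete splitting of `y^q - y = w`** (Stichtenoth Prop. 3.7.8 (d) / 3.7.10 (d), Cor. 3.3.8 (b);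
Lemma 7.4.4 of the Garcia–Stichtenoth tower): if `T^q - T - w̄` has `q` distinct roots `c̄ⱼ`
(`cⱼ ∈ K`) in `F_P`, then there are `q` distinct places `Pⱼ` above `P` with `deg Pⱼ = deg P` and
`y ≡ cⱼ (mod Pⱼ)`. [cite: Stichtenoth2009, Prop. 3.7.10 and Lemma 7.4.4] -/
theorem exists_placesOver_of_pow_sub_eq_of_roots (P : PlaceOver K F) {q : ℕ} (hq : 2 ≤ q)
    {y : F'} {w : F} (hw : w ∈ P.toValuationSubring)
    (hy : y ^ q - y = algebraMap F F' w) (htop : F⟮y⟯ = ⊤) (hdeg : Module.finrank F F' = q)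
    (c : Fin q → K) (hcinj : Function.Injective c)
    (hc : ∀ j, P.valuation (algebraMap K F (c j) ^ q - algebraMap K F (c j) - w) < 1) :
    ∃ Ψ : Fin q → PlaceOver K F', Function.Injective Ψ ∧ ∀ j,
      (Ψ j).restrict (K := K) (F := F) = P ∧ (Ψ j).degree = P.degree ∧
      (Ψ j).valuation (y - algebraMap K F' (c j)) < 1 := by
  set φ : (P.toValuationSubring)[X] := X ^ q - X - C ⟨w, hw⟩ with hφ
  have hφm : φ.Monic := monic_X_pow_sub_X_sub_C _ hq
  have hφmap : φ.map (algebraMap P.toValuationSubring F) = X ^ q - X - C w := by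
    simp only [hφ, Polynomial.map_sub, Polynomial.map_pow, map_X, map_C]; rfl
  have hmin : minpoly F y = φ.map (algebraMap P.toValuationSubring F) := by
    rw [hφmap]; exact minpoly_eq_of_pow_sub_eq hq hy htop hdeg
  have hnat : φ.natDegree = q := natDegree_X_pow_sub_X_sub_C _ hq
  -- the reduction and its roots
  set cb : Fin q → P.residueField := fun j =>
    IsLocalRing.residue P.toValuationSubring (algebraMap K P.toValuationSubring (c j)) with hcb
  have hcbinj : Function.Injective cb := fun i j hij => hcinj
    ((algebraMap K P.residueField).injective hij)
  set φb := φ.map (IsLocalRing.residue P.toValuationSubring) with hφb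
  have hφb : φb = X ^ q - X - C (IsLocalRing.residue P.toValuationSubring ⟨w, hw⟩) := by
    simp only [φb, hφ, Polynomial.map_sub, Polynomial.map_pow, map_X, map_C]
  have hroot : ∀ j, φb.IsRoot (cb j) := by
    intro j
    rw [hφb, IsRoot.def, eval_sub, eval_sub, eval_pow, eval_X, eval_C, hcb]
    change IsLocalRing.residue _ _ ^ q - IsLocalRing.residue _ _ - IsLocalRing.residue _ _ = 0
    rw [← map_pow, ← map_sub, ← map_sub, IsLocalRing.residue_eq_zero_iff,
      ValuationSubring.valuation_lt_one_iff]
    exact hc j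
  set S := (Finset.univ : Finset (Fin q)).image (fun j => X - C (cb j)) with hS
  have hγinj : Function.Injective (fun j => (X - C (cb j) : (P.residueField)[X])) :=
    fun i j hij => hcbinj (C_injective (sub_right_injective hij))
  have hprod : ∏ γ ∈ S, γ = φb := by
    rw [hS, Finset.prod_image fun i _ j _ hij => hγinj hij]
    symm
    refine Polynomial.eq_of_monic_of_dvd_of_natDegree_le (monic_prod_of_monic _ _ fun j _ =>
      monic_X_sub_C _) (hφm.map _) ?_ ?_
    · exact Finset.prod_dvd_of_coprime
        (fun i _ j _ hij => pairwise_coprime_X_sub_C hcbinj hij)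
        (fun j _ => dvd_iff_isRoot.2 (hroot j))
    · rw [hφm.natDegree_map, hnat, natDegree_prod _ _ (fun j _ => X_sub_C_ne_zero _)]
      simp
  obtain ⟨Φ, hinj, -, hspec⟩ := P.exists_placesOver_of_prod_eq hφm hmin (by rw [hdeg, hnat]) S
    (fun γ hγ => by obtain ⟨j, -, rfl⟩ := Finset.mem_image.1 hγ; exact irreducible_X_sub_C _)
    (fun γ hγ => by obtain ⟨j, -, rfl⟩ := Finset.mem_image.1 hγ; exact monic_X_sub_C _) hprod
  have hmemS : ∀ j, (X - C (cb j) : (P.residueField)[X]) ∈ S := fun j =>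
    Finset.mem_image.2 ⟨j, Finset.mem_univ _, rfl⟩
  refine ⟨fun j => Φ (X - C (cb j)), fun i j hij => hγinj (hinj (hmemS i) (hmemS j) hij), fun j => ?_⟩
  dsimp only
  obtain ⟨hres, hroot', -, hdegj⟩ := hspec _ (hmemS j)
  refine ⟨hres, by rw [hdegj, natDegree_X_sub_C, one_mul], ?_⟩
  have hBP := PlaceOver.forall_mem_iff_of_restrict_eq hres
  have hyO : y ∈ (Φ (X - C (cb j))).toValuationSubring := PlaceOver.mem_of_pow_sub_eq hres hq hy hw
  have hr := hroot' hBP hyO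
  rw [Polynomial.map_sub, map_X, map_C, map_sub, aeval_X, aeval_C, sub_eq_zero] at hr
  have hcj : algebraMap K F' (c j) ∈ (Φ (X - C (cb j))).toValuationSubring := PlaceOver.algebraMap_mem _ _
  have : IsLocalRing.residue (Φ (X - C (cb j))).toValuationSubring ⟨y, hyO⟩ =
      IsLocalRing.residue (Φ (X - C (cb j))).toValuationSubring ⟨algebraMap K F' (c j), hcj⟩ := by
    rw [hr]
    change IsLocalRing.residue _ (resHom P _ hBP (algebraMap K P.toValuationSubring (c j))) = _
    congr 1
    apply Subtype.ext
    change algebraMap F F' (algebraMap K F (c j)) = algebraMap K F' (c j)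
    exact (IsScalarTower.algebraMap_apply K F F' (c j)).symm
  exact (residue_eq_residue_iff _ _ _).1 this

end PlaceOver

end Literature.NumberTheory.DiophantineGeometry.AlgFunctionField
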